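import Summits.NavierStokesRegularity.NavierStokesRegularity.Theorems.WakeRatchetEternalViscousRateNoConveyorVisc
import Summits.NavierStokesRegularity.NavierStokesRegularity.Theorems.WakeRatchetBlockRatioLeOne

/-!
# Crux `WakeRatchet.EternalInviscidRate` (⟨stmt-NavierStokesRegularity-25646⟩) — RETENTION COSTS ACTION:
# quantitative sub-unitarity of every block-self-similar admissible front, `ϱ ≤ (1 − e^{−2C_AΛ⁻¹A})^p`,
# and the converse reading of the action-budget reduction on the self-similar stratum

The landed leak ratchet (inviscid p817248, any covariant viscosity p817499/p817612: `tail_le_leak_pow_visc`) contracts tails by the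
solution-dependent factor `1 − e^{−2C_AΛ⁻¹A}` per shell (`A ≥ ∫_ℝ‖W_k‖` for every shell, `C_A = fluxConst α`, `Λ = bigLam ε₀`); on a
block-self-similar solution `W_{n+p}(σ) = W_n(σ − T)` the tail above `n+p` IS `ϱ ×` the (time-shifted) tail above `n`, `ϱ = e^{2T}Λ^{−2p}` the block
energy ratio (`WakeRatchetDSS.tail_shift`).  Comparing the two at the supremum of the tail:
* `blockRatio_le_leak` — **QUANTITATIVE SUB-UNITARITY**: for every uniformly bounded admissible eternal solution (any `ν̂ ≥ 0`, any `m`) of a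
  cancelling table that is block-self-similar with period `p` and does not vanish identically, `ϱ ≤ (1 − e^{−2C_AΛ⁻¹A})^p`.  (g1's
  `blockDSS_ratio_lt_one` / `NoUnitaryFront` is the qualitative `ϱ < 1`; here the wake fraction per shell, in geometric mean, is at least `e^{−2C_AΛ⁻¹A}`.)
* `dssWave_dssMu_le_leak` — for every non-trivial admissible DSS wave (`IsDSSWave`, any profile family / shape permutation):
  `dssMu ε₀ T ≤ 1 − exp(−2C_AΛ⁻¹·∫_ℝ Σ_r‖Φ_r‖)` — the per-shell retention is bounded by the summed profile MASS (the `mass` clause).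
* `neg_log_one_sub_dssMu_le_action` — equivalently **RETENTION COSTS ACTION**: `−log(1 − dssMu) ≤ 2C_AΛ⁻¹·∫_ℝ Σ_r‖Φ_r‖`.  A front retaining
  `dssMu = 1 − θε₀` per shell needs summed profile mass `≥ (Λ/2C_A)·log(1/(θε₀))`: slow fronts are logarithmically expensive, and K41-type
  fronts (`θ = 5/3`) necessarily carry mass `≳ log(1/ε₀)` in self-similar units.
* `actionBudget_pins_dssMu` — CONVERSE READING of this generation's reduction `FinalWakeLedger.EternalInviscidRate_of_actionBudget` (p818490) on
  the self-similar stratum: if a non-trivial DSS front satisfies the rate-`a` action budget with its own mass, `2C_AΛ⁻¹∫Σ_r‖Φ_r‖ ≤ −log(1−(1+ε₀)^{−a})`,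
  then `dssMu ≤ (1+ε₀)^{−a}` AND the budget is two-sidedly pinned, `−log(1 − dssMu) ≤ 2C_AΛ⁻¹∫Σ‖Φ‖ ≤ −log(1 − (1+ε₀)^{−a})`: the budget can hold
  only where the Cauchy–Schwarz flux bound `|F_n| ≤ 2C_AΛ⁻¹‖W_{n+1}‖E_n` is saturated up to the factor `log(1−(1+ε₀)^{−a})/log(1−dssMu)` —
  i.e. the leak mechanism delivers the rate crux only when it is TIGHT (census: the action-budget route is a bookkeeping identity, not a method).
MODEL lattice only (Tao 2016 §4 renormalised cascade); nothing here is a statement about the Navier–Stokes equations; no registered stub of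
skeleton d183ebc2 is closed; no summit is proved by this file.
[cite: Tao2016AveragedNS, §4 Lemma 4.1 (4.8)–(4.10) with the cancellation (4.3), the viscous equation before Thm. 4.2, §6.4]
-/

noncomputable section

set_option linter.dupNamespace false

namespace Summit.NavierStokesRegularity.NavierStokesRegularity.Theorems

namespace WakeRatchetDSS

open Filter Topology Set MeasureTheory
open Literature.Analysis.FluidPDE Literature.Analysis.FluidPDE.TaoCascade
open WakeRatchetTail
open Summit.NavierStokesRegularity.NavierStokesRegularity.Cruxes.EternalViscousRate.DissipationEdge

variable {m : ℕ} {ε₀ νh : ℝ} {α : Fin m → Fin m → Fin m → ℤ × ℤ × ℤ → ℝ} {W : ℤ → ℝ → Em m}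

/-- **Quantitative sub-unitarity.**  A uniformly bounded admissible eternal solution of a cancelling table (any covariant viscosity
`ν̂ ≥ 0`, `ε₀ > 0`) with per-shell action `∫_ℝ‖W_k‖ ≤ A`, block-self-similar with period `p` and lag `T` and not identically zero, has block
energy ratio `e^{2T}Λ^{−2p} ≤ (1 − e^{−2C_AΛ⁻¹A})^p`.  Proof: at the supremum `Θ` of the tail above a charged shell `n₀`, the block identity
`T_{n₀+p}(σ) = ϱ·T_{n₀}(σ − T)` and the iterated leak ratchet `T_{n₀+p} ≤ (1 − e^{−2C_AΛ⁻¹A})^p·Θ` give `ϱΘ ≤ (1 − e^{−cA})^pΘ` with `Θ > 0`.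
MODEL lattice only.  [cite: Tao2016AveragedNS, §4 Lemma 4.1 (4.8)–(4.10), (4.3), §6.4] -/
theorem blockRatio_le_leak (hε : 0 < ε₀) (hc : IsCancellingCoeff α) (hW : IsEternalVisc ε₀ νh α W)
    (hU : UniformBound W) {A : ℝ} (hA : ∀ k : ℤ, Integrable (fun σ => ‖W k σ‖) ∧ ∫ σ, ‖W k σ‖ ≤ A)
    {p : ℕ} {T : ℝ} (hD : ∀ (n : ℤ) (σ : ℝ), W (n + p) σ = W n (σ - T))
    {n₀ : ℤ} {σ₀ : ℝ} (hne : W n₀ σ₀ ≠ 0) :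
    Real.exp (2 * T) * (bigLam ε₀ ^ p)⁻¹ ^ 2 ≤ (1 - Real.exp (-(2 * fluxConst α * (bigLam ε₀)⁻¹ * A))) ^ p := by
  set ϱ : ℝ := Real.exp (2 * T) * (bigLam ε₀ ^ p)⁻¹ ^ 2 with hϱ
  set q : ℝ := 1 - Real.exp (-(2 * fluxConst α * (bigLam ε₀)⁻¹ * A)) with hq
  set S : ℝ → ℝ := fun σ => ∑' k : ℕ, physEnergy ε₀ W (n₀ + k) σ with hS
  have hρ0 : 0 < ϱ := blockRatio_pos hε p T
  -- the tail above `n₀` is globally bounded; take its supremum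
  obtain ⟨M, hM⟩ := TailEnvelopeFinite.main hε hc hW hU n₀
  have hbdd : BddAbove (Set.range S) := ⟨M, by rintro _ ⟨σ, rfl⟩; exact hM σ⟩
  set Θ : ℝ := ⨆ σ, S σ with hΘ
  have hSΘ : ∀ σ : ℝ, S σ ≤ Θ := fun σ => le_ciSup hbdd σ
  -- leak ratchet over one block, at the supremum
  have hstep : ∀ σ : ℝ, ϱ * S (σ - T) ≤ q ^ p * Θ := by
    intro σ
    have h1 := tail_shift hε hD n₀ σ
    have h2 := tail_le_leak_pow_visc hε hc hW hU hA n₀ hSΘ p σ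
    rw [h1] at h2
    exact h2
  have hΘle : Θ ≤ q ^ p * Θ / ϱ := by
    refine ciSup_le fun s => ?_
    have h := hstep (s + T)
    rw [add_sub_cancel_right] at h
    rw [le_div_iff₀ hρ0]
    linarith
  have hΘpos : 0 < Θ :=
    lt_of_lt_of_le (lt_of_lt_of_le (physEnergy_pos_of_ne hε hne) (physEnergy_le_tail hε hU n₀ σ₀)) (hSΘ σ₀)
  have hmul : ϱ * Θ ≤ q ^ p * Θ := by
    have h := mul_le_mul_of_nonneg_left hΘle hρ0.le
    rwa [mul_div_cancel₀ _ hρ0.ne'] at h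
  exact le_of_mul_le_mul_right hmul hΘpos

/-- **Retention of a DSS front is bounded by its summed profile mass.**  For a cancelling table, `ε₀ > 0`, and a non-trivial admissible DSS wave
`IsDSSWave ε₀ α π T Φ` (any finite profile family, any shape permutation, any delay): `dssMu ε₀ T ≤ 1 − exp(−2C_AΛ⁻¹·∫_ℝ Σ_r ‖Φ_r‖)`.
MODEL lattice only.  [cite: Tao2016AveragedNS, §4 Lemma 4.1 (4.8)–(4.10), (4.3), §6.4] -/
theorem dssWave_dssMu_le_leak (hε : 0 < ε₀) {ρ : Type*} [Fintype ρ] (hc : IsCancellingCoeff α)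
    {π : Equiv.Perm ρ} {T : ℝ} {Φ : ρ → ℝ → Em m} (h : IsDSSWave ε₀ α π T Φ) {r : ρ} {x : ℝ} (hne : Φ r x ≠ 0) :
    dssMu ε₀ T ≤ 1 - Real.exp (-(2 * fluxConst α * (bigLam ε₀)⁻¹ * ∫ σ, sMass Φ σ)) := by
  have hp : 0 < orderOf π := orderOf_pos π
  have hW : IsEternal ε₀ α (dssEmbed π T Φ r) := h.isEternal_dssEmbed r
  have hU : UniformBound (dssEmbed π T Φ r) := uniformBound_dssEmbed h r
  have hne' : dssEmbed π T Φ r 0 x ≠ 0 := by simpa [dssEmbed] using hne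
  -- the action of every embedded shell is at most the summed profile mass
  have hA : ∀ k : ℤ, Integrable (fun σ => ‖dssEmbed π T Φ r k σ‖) ∧
      ∫ σ, ‖dssEmbed π T Φ r k σ‖ ≤ ∫ σ, sMass Φ σ := by
    intro k
    have hcont : Continuous (Φ ((π ^ k) r)) :=
      continuous_iff_continuousAt.2 fun y => (h.wave ((π ^ k) r) y).continuousAt
    have hmeas : AEStronglyMeasurable (fun σ => ‖dssEmbed π T Φ r k σ‖) volume := by
      have : Continuous fun σ => ‖dssEmbed π T Φ r k σ‖ :=
        (hcont.comp (continuous_id.sub continuous_const)).norm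
      exact this.aestronglyMeasurable
    have hdom : Integrable (fun σ => sMass Φ (σ - k * T)) := h.mass.comp_sub_right (k * T)
    have hint : Integrable (fun σ => ‖dssEmbed π T Φ r k σ‖) := by
      refine hdom.mono' hmeas (Filter.Eventually.of_forall fun σ => ?_)
      rw [norm_norm]
      exact norm_le_sMass Φ _ _
    refine ⟨hint, ?_⟩
    calc ∫ σ, ‖dssEmbed π T Φ r k σ‖ ≤ ∫ σ, sMass Φ (σ - k * T) :=
          integral_mono hint hdom fun σ => norm_le_sMass Φ _ _
      _ = ∫ σ, sMass Φ σ := integral_sub_right_eq_self (fun σ => sMass Φ σ) (k * T)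
  have hle := blockRatio_le_leak hε hc hW.isEternalVisc hU hA (T := orderOf π * T) (dssEmbed_shift π T Φ r) hne'
  rw [blockRatio_orderOf_eq_pow hε.le] at hle
  have hμ0 : 0 ≤ dssMu ε₀ T := (dssMu_pos T (by linarith)).le
  have hq0 : 0 ≤ 1 - Real.exp (-(2 * fluxConst α * (bigLam ε₀)⁻¹ * ∫ σ, sMass Φ σ)) := by
    have hCA : 0 ≤ fluxConst α := fluxConst_nonneg α
    have hΛ : 0 < bigLam ε₀ := bigLam_pos (by linarith)
    have hI : 0 ≤ ∫ σ, sMass Φ σ := integral_nonneg fun σ => sMass_nonneg Φ σ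
    have : Real.exp (-(2 * fluxConst α * (bigLam ε₀)⁻¹ * ∫ σ, sMass Φ σ)) ≤ 1 :=
      Real.exp_le_one_iff.mpr (by have := inv_nonneg.mpr hΛ.le; nlinarith [mul_nonneg (mul_nonneg hCA this) hI])
    linarith
  exact (pow_le_pow_iff_left₀ hμ0 hq0 hp.ne').1 hle

/-- **Retention costs action.**  For a non-trivial admissible DSS wave of a cancelling table (`ε₀ > 0`):
`−log(1 − dssMu ε₀ T) ≤ 2C_AΛ⁻¹·∫_ℝ Σ_r ‖Φ_r‖` — a front keeping the fraction `dssMu = 1 − θε₀` per shell has summed profile mass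
`≥ (Λ/2C_A)·log(1/(θε₀))`.  MODEL lattice only.  [cite: Tao2016AveragedNS, §4 Lemma 4.1 (4.8)–(4.10), (4.3), §6.4] -/
theorem neg_log_one_sub_dssMu_le_action (hε : 0 < ε₀) {ρ : Type*} [Fintype ρ] (hc : IsCancellingCoeff α)
    {π : Equiv.Perm ρ} {T : ℝ} {Φ : ρ → ℝ → Em m} (h : IsDSSWave ε₀ α π T Φ) {r : ρ} {x : ℝ} (hne : Φ r x ≠ 0) :
    -Real.log (1 - dssMu ε₀ T) ≤ 2 * fluxConst α * (bigLam ε₀)⁻¹ * ∫ σ, sMass Φ σ := by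
  have hle := dssWave_dssMu_le_leak hε hc h hne
  have hexp : Real.exp (-(2 * fluxConst α * (bigLam ε₀)⁻¹ * ∫ σ, sMass Φ σ)) ≤ 1 - dssMu ε₀ T := by linarith
  have hpos : 0 < 1 - dssMu ε₀ T := lt_of_lt_of_le (Real.exp_pos _) hexp
  have hlog := Real.log_le_log (Real.exp_pos _) hexp
  rw [Real.log_exp] at hlog
  linarith

/-- **The action budget pins the retention two-sidedly (converse reading of `EternalInviscidRate_of_actionBudget` on DSS fronts).**  If a
non-trivial admissible DSS wave of a cancelling table satisfies the rate-`a` action budget with its own summed mass,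
`2C_AΛ⁻¹·∫_ℝ Σ_r‖Φ_r‖ ≤ −log(1 − (1+ε₀)^{−a})`, then `dssMu ≤ (1+ε₀)^{−a}` and
`−log(1 − dssMu) ≤ 2C_AΛ⁻¹·∫Σ‖Φ‖ ≤ −log(1 − (1+ε₀)^{−a})`.  MODEL lattice only.
[cite: Tao2016AveragedNS, §4 Lemma 4.1 (4.8)–(4.10), (4.3), §6.4] -/
theorem actionBudget_pins_dssMu (hε : 0 < ε₀) {ρ : Type*} [Fintype ρ] (hc : IsCancellingCoeff α)
    {π : Equiv.Perm ρ} {T : ℝ} {Φ : ρ → ℝ → Em m} (h : IsDSSWave ε₀ α π T Φ) {r : ρ} {x : ℝ} (hne : Φ r x ≠ 0)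
    {a : ℝ} (hB : 2 * fluxConst α * (bigLam ε₀)⁻¹ * ∫ σ, sMass Φ σ ≤ -Real.log (1 - (1 + ε₀) ^ (-a))) :
    dssMu ε₀ T ≤ (1 + ε₀) ^ (-a) ∧
      -Real.log (1 - dssMu ε₀ T) ≤ 2 * fluxConst α * (bigLam ε₀)⁻¹ * ∫ σ, sMass Φ σ ∧
      2 * fluxConst α * (bigLam ε₀)⁻¹ * ∫ σ, sMass Φ σ ≤ -Real.log (1 - (1 + ε₀) ^ (-a)) := by
  have hlow := neg_log_one_sub_dssMu_le_action hε hc h hne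
  refine ⟨?_, hlow, hB⟩
  have hle := dssWave_dssMu_le_leak hε hc h hne
  have hpos : 0 < 1 - dssMu ε₀ T := by
    have : Real.exp (-(2 * fluxConst α * (bigLam ε₀)⁻¹ * ∫ σ, sMass Φ σ)) ≤ 1 - dssMu ε₀ T := by linarith
    exact lt_of_lt_of_le (Real.exp_pos _) this
  -- `-log(1-μ) ≤ -log(1-λ^{-a})` ⇒ `1 - λ^{-a} ≤ 1 - μ`
  have hchain : -Real.log (1 - dssMu ε₀ T) ≤ -Real.log (1 - (1 + ε₀) ^ (-a)) := hlow.trans hB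
  by_contra hgt
  push Not at hgt
  -- then `1 - λ^{-a} > 1 - μ > 0`, so `log(1 - λ^{-a}) > log(1-μ)`: contradiction
  have h2 : 1 - dssMu ε₀ T < 1 - (1 + ε₀) ^ (-a) := by linarith
  have h3 := Real.log_lt_log hpos h2
  linarith

end WakeRatchetDSS

end Summit.NavierStokesRegularity.NavierStokesRegularity.Theorems

end
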